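import Summits.HodgeConjecture.CorCM.MumfordTateRankRigidMonotone
import Summits.HodgeConjecture.CorCM.MumfordTateRankTimesNonCMCurve
import Literature.AlgebraicGeometry.Motives.HodgeLieRigidTimesNonCMCurve
import HarnessLib

/-!
# `Θ`-rigidity is inherited along a NON-CM elliptic curve: `H¹A` rigid, `Hom(A, E) = 0` ⟹ `H¹(A × E)` rigid; `t((A × E) × Y) ≥ t(A) + 3`
# (Moonen–Zarhin 1999 Lemma (3.4) with (3.1), for an arbitrary bracket-closed subalgebra carrying the Hodge operator)

COR-CM (cell `pub-hodgecm2`, seat `b27` gen 51, count-neutral Mumford–Tate-rank ladder; theorems only, no definition, no named fact;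
UNCONDITIONAL — nothing here uses or asserts HC_CM).  Notation `t(X) = dim MT(H¹X) = dim Lie Hg(H¹X) + 1`.

The complex-abelian-variety reading of `Motives/HodgeLieRigidTimesNonCMCurve`: the bicone `H¹(A × E) = fst^* H¹A ⊕ snd^* H¹E`, `End_Hdg(H¹E) = ℚ`
for a non-CM curve, and «`Hom(A, E) = 0` ⟹ no non-zero Hodge morphism `H¹E → H¹A`» (Riemann, `forall_isHodgeMorphismOne_eq_zero_of_forall_hom_eq_zero`),
exactly as in `CorCM/MumfordTateRankTimesNonCMCurve` (gen 47, the dimension statement `t(A × E) = t(A) + 3`).  Together with the CM steps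
(`CorCM/MumfordTateRankTypeIVTimesCMCurveRigid`, `CorCM/MumfordTateRankCMCurvesTowerRigid`) every product of a `Θ`-rigid `A` with elliptic curves
stays `Θ`-rigid, so the rigid-factor monotonicity `t(X × Y) ≥ t(X)` (`CorCM/MumfordTateRankRigidMonotone`) bounds all further products.

* §1 **`hodgeLie_rigid_prod_nonCMCurve_of_rigid`** — `H¹A` `Θ`-rigid, `E` a non-CM elliptic curve, `Hom(A, E) = 0` ⟹ `H¹(A × E)` `Θ`-rigid;
  `hodgeLie_rigid_isSimple_prod_nonCMCurve_of_rigid` (`A` simple of dimension `≥ 2`: `Hom(A, E) = 0` automatically).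
* §2 **`mtRank_hodge_one_add_three_le_of_isIsogenous_prod_nonCMCurve_prod_of_rigid`** — `t(A) + 3 ≤ t(X)` for every `X ∼ (A × E) × Y`;
  cells: simple type-IV(2,1) threefold `T`: `H¹(T × E)` rigid and **`13 ≤ t((T × E) × Y)`**; Ribet type `(g − 1, 1)`: **`g² + 4 ≤ t`**.

## References
* [MoonenZarhin1999LowDim] B. Moonen, Yu. G. Zarhin, *Hodge classes on abelian varieties of low dimension*, Math. Ann. 315 (1999), §2 (2.3), §3 (3.1),
  Lemma (3.4), Prop. (3.8) [corpus: paper:arxiv-math_9901113 pp. 5–7]. [cite: MoonenZarhin1999LowDim, §3 (3.1) and Lemma (3.4)]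
* [DeligneMilne1982Tannakian] P. Deligne, J. S. Milne, *Tannakian categories*, LNM 900 (1982), §6 Thm. 6.20 (Riemann). [cite: DeligneMilne1982Tannakian, §6 Thm. 6.20]
* [Ribet1983] K. A. Ribet, Amer. J. Math. 105 (1983), Thm. 3. [cite: Ribet1983, Thm. 3]
-/

noncomputable section

open scoped TensorProduct
open CategoryTheory CategoryTheory.Limits Module

namespace Summit.HodgeConjecture.CorCM

open Literature.AlgebraicGeometry.Motives
open Literature.AlgebraicGeometry.Motives.AbelianVariety
open Literature.AlgebraicGeometry.Motives.HodgeStructure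
open Literature.AlgebraicGeometry.HodgeTheory
open Literature.AlgebraicGeometry.ComplexMultiplication
open Literature.AlgebraicGeometry.Milne1999 (IsOfCMType hom_eq_zero_of_isSimple_of_not_isIsogenous)

variable [HodgeTensorFacts.{0, 0}] {X A E : AbelianVariety ℂ} {n n₁ l : ℕ}

/-! ## §1 Rigidity along a non-CM curve -/

/-- **`H¹(A × E)` is `Θ`-rigid for `Θ`-rigid `H¹A`, a non-CM elliptic curve `E` and `Hom(A, E) = 0`**: Moonen–Zarhin's Lemma (3.4) applied to an
arbitrary bracket-closed rational `𝔞 ⊆ Lie Hg(H¹(A × E))` carrying a Hodge operator (`Motives/HodgeLieRigidTimesNonCMCurve`) on the bicone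
`fst^* H¹A ⊕ snd^* H¹E`; `End_Hdg(H¹E) = ℚ` (`curve_facts_of_not_isOfCMType`), `Hom(A, E) = 0` in Hodge-piece form by Riemann's theorem.
[cite: MoonenZarhin1999LowDim, §3 (3.1) and Lemma (3.4)] [cite: DeligneMilne1982Tannakian, §6 Thm. 6.20] -/
theorem hodgeLie_rigid_prod_nonCMCurve_of_rigid (hA : IsSmoothProjective n₁ A.X) (hP : IsSmoothProjective l (A.prod E).X)
    (hrigA : haveI := BettiUniverse.finite hA 1
      ∀ 𝔞 : Submodule ℚ (Module.End ℚ (bettiCohomology A.X 1)),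
        𝔞 ≤ (BettiUniverse.hodge exists_isReal_hodgeModel_holds hA 1).hodgeLie →
        (∀ B ∈ 𝔞, ∀ B' ∈ 𝔞, B * B' - B' * B ∈ 𝔞) →
        (∃ Θ ∈ Submodule.span ℂ ((fun B : Module.End ℚ (bettiCohomology A.X 1) => B.baseChange ℂ) ''
            (𝔞 : Set (Module.End ℚ (bettiCohomology A.X 1)))),
          ∀ p, ∀ x ∈ (BettiUniverse.hodge exists_isReal_hodgeModel_holds hA 1).piece p (((1 : ℕ) : ℤ) - p),
            Θ x = ((2 * p - ((1 : ℕ) : ℤ) : ℤ) : ℂ) • x) →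
        (BettiUniverse.hodge exists_isReal_hodgeModel_holds hA 1).hodgeLie ≤ 𝔞)
    (hE1 : E.dim = 1) (hEcm : ¬ IsOfCMType E) (hAE : ∀ u : A ⟶ E, u = 0) :
    haveI := BettiUniverse.finite hP 1
    ∀ 𝔞 : Submodule ℚ (Module.End ℚ (bettiCohomology (A.prod E).X 1)),
      𝔞 ≤ (BettiUniverse.hodge exists_isReal_hodgeModel_holds hP 1).hodgeLie →
      (∀ B ∈ 𝔞, ∀ B' ∈ 𝔞, B * B' - B' * B ∈ 𝔞) →
      (∃ Θ ∈ Submodule.span ℂ ((fun B : Module.End ℚ (bettiCohomology (A.prod E).X 1) => B.baseChange ℂ) ''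
          (𝔞 : Set (Module.End ℚ (bettiCohomology (A.prod E).X 1)))),
        ∀ p, ∀ x ∈ (BettiUniverse.hodge exists_isReal_hodgeModel_holds hP 1).piece p (((1 : ℕ) : ℤ) - p),
          Θ x = ((2 * p - ((1 : ℕ) : ℤ) : ℤ) : ℂ) • x) →
      (BettiUniverse.hodge exists_isReal_hodgeModel_holds hP 1).hodgeLie ≤ 𝔞 := by
  classical
  have hnA : A.dim = n₁ := schemeDim_eq_holds hA
  subst hnA
  have hE : IsSmoothProjective E.dim E.X := AbelianVariety.isSmoothProjective_holds
  haveI := BettiUniverse.finite hP 1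
  haveI := BettiUniverse.finite hA 1
  haveI := BettiUniverse.finite hE 1
  have hHD : exists_isReal_hodgeModel := exists_isReal_hodgeModel_holds
  have hI : hodgePQ_independent_of_hodgeModel := hodgePQ_independent_of_hodgeModel_holds
  obtain ⟨-, hEend, -, -⟩ := curve_facts_of_not_isOfCMType hE1 hEcm
  -- the bicone of `H¹`
  let ι₁ := BettiUniverse.pullHodgeHom hHD hI hP hA (fst A E).hom.hom.hom 1
  let π₁ := BettiUniverse.pullHodgeHom hHD hI hA hP (prodLift (𝟙 A) (0 : A ⟶ E)).hom.hom.hom 1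
  let ι₂ := BettiUniverse.pullHodgeHom hHD hI hP hE (snd A E).hom.hom.hom 1
  let π₂ := BettiUniverse.pullHodgeHom hHD hI hE hP (prodLift (0 : E ⟶ A) (𝟙 E)).hom.hom.hom 1
  have hsumP : fst A E ≫ prodLift (𝟙 A) (0 : A ⟶ E) + snd A E ≫ prodLift (0 : E ⟶ A) (𝟙 E) = 𝟙 _ := by
    refine prod_hom_ext ?_ ?_
    · rw [Preadditive.add_comp, Category.assoc, Category.assoc, prodLift_fst, prodLift_fst, Category.comp_id,
        comp_zero, add_zero, Category.id_comp]
    · rw [Preadditive.add_comp, Category.assoc, Category.assoc, prodLift_snd, prodLift_snd, Category.comp_id,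
        comp_zero, zero_add, Category.id_comp]
  have hπι₁ : ∀ v, π₁.toLinearMap (ι₁.toLinearMap v) = v := fun v => pull_pull_eq_self_of_comp_eq_id (prodLift_fst _ _) v
  have hπι₂ : ∀ v, π₂.toLinearMap (ι₂.toLinearMap v) = v := fun v => pull_pull_eq_self_of_comp_eq_id (prodLift_snd _ _) v
  have hsum : ∀ v, ι₁.toLinearMap (π₁.toLinearMap v) + ι₂.toLinearMap (π₂.toLinearMap v) = v := fun v =>
    pull_pull_add_pull_pull_eq_self _ _ _ _ hsumP v
  -- the data of `H¹(E)`: polarizations, `End_Hdg = ℚ`, `dim = 2`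
  obtain ⟨ψ₁⟩ := BettiUniverse.hodge_isPolarizable hHD hA 1
  obtain ⟨ψ₂⟩ := BettiUniverse.hodge_isPolarizable hHD hE 1
  have hE₂ := exists_eq_smul_one_of_finrank_endAlgebra_eq_one (A := E) hHD hI hEend (by omega)
  have hV₂ : Module.finrank ℚ (bettiCohomology E.X 1) = 2 := by rw [finrank_bettiCohomology_one E, hE1]
  -- `Hom(A, E) = 0` in piece form
  have hHom : ∀ f : bettiCohomology E.X 1 →ₗ[ℚ] bettiCohomology A.X 1,
      (∀ r : ℤ, ∀ x ∈ (BettiUniverse.hodge hHD hE 1).piece r (((1 : ℕ) : ℤ) - r),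
        f.baseChange ℂ x ∈ (BettiUniverse.hodge hHD hA 1).piece r (((1 : ℕ) : ℤ) - r)) → f = 0 := by
    intro f hf
    refine forall_isHodgeMorphismOne_eq_zero_of_forall_hom_eq_zero hAE f ⟨fun x hx => ?_, fun x hx => ?_⟩
    · have hx' := (BettiUniverse.mem_hodge_piece_iff hHD hI hE (k := 1) (p := 1) (q := 0) rfl _).2 hx
      have e : (((1 : ℕ) : ℤ) - 1) = 0 := by norm_num
      have h := hf 1 x (by rw [e]; exact hx')
      rw [e] at h
      exact (BettiUniverse.mem_hodge_piece_iff hHD hI hA (k := 1) (p := 1) (q := 0) rfl _).1 h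
    · have hx' := (BettiUniverse.mem_hodge_piece_iff hHD hI hE (k := 1) (p := 0) (q := 1) rfl _).2 hx
      have e : (((1 : ℕ) : ℤ) - 0) = 1 := by norm_num
      have h := hf 0 x (by rw [e]; exact hx')
      rw [e] at h
      exact (BettiUniverse.mem_hodge_piece_iff hHD hI hA (k := 1) (p := 0) (q := 1) rfl _).1 h
  exact (finrank_eq_add_three_and_rigid_of_nonCMCurve_summand_of_rigid ι₁ π₁ ι₂ π₂ hπι₁ hπι₂ hsum Nat.cast_one
    (BettiUniverse.hodge_isEffective hHD hA 1) (BettiUniverse.hodge_isEffective hHD hE 1) ψ₁ ψ₂ hE₂ hV₂ hHom hrigA).2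

/-- **`H¹(A × E)` is `Θ`-rigid for a SIMPLE `A` of dimension `≥ 2` with `Θ`-rigid `H¹A` and a non-CM elliptic curve `E`** (`Hom(A, E) = 0`
automatically: simple of different dimensions). [cite: MoonenZarhin1999LowDim, §3 (3.1) and Lemma (3.4)] -/
theorem hodgeLie_rigid_isSimple_prod_nonCMCurve_of_rigid (hA : IsSmoothProjective n₁ A.X) (hP : IsSmoothProjective l (A.prod E).X)
    (hAs : A.IsSimple) (hA2 : 2 ≤ A.dim)
    (hrigA : haveI := BettiUniverse.finite hA 1
      ∀ 𝔞 : Submodule ℚ (Module.End ℚ (bettiCohomology A.X 1)),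
        𝔞 ≤ (BettiUniverse.hodge exists_isReal_hodgeModel_holds hA 1).hodgeLie →
        (∀ B ∈ 𝔞, ∀ B' ∈ 𝔞, B * B' - B' * B ∈ 𝔞) →
        (∃ Θ ∈ Submodule.span ℂ ((fun B : Module.End ℚ (bettiCohomology A.X 1) => B.baseChange ℂ) ''
            (𝔞 : Set (Module.End ℚ (bettiCohomology A.X 1)))),
          ∀ p, ∀ x ∈ (BettiUniverse.hodge exists_isReal_hodgeModel_holds hA 1).piece p (((1 : ℕ) : ℤ) - p),
            Θ x = ((2 * p - ((1 : ℕ) : ℤ) : ℤ) : ℂ) • x) →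
        (BettiUniverse.hodge exists_isReal_hodgeModel_holds hA 1).hodgeLie ≤ 𝔞)
    (hE1 : E.dim = 1) (hEcm : ¬ IsOfCMType E) :
    haveI := BettiUniverse.finite hP 1
    ∀ 𝔞 : Submodule ℚ (Module.End ℚ (bettiCohomology (A.prod E).X 1)),
      𝔞 ≤ (BettiUniverse.hodge exists_isReal_hodgeModel_holds hP 1).hodgeLie →
      (∀ B ∈ 𝔞, ∀ B' ∈ 𝔞, B * B' - B' * B ∈ 𝔞) →
      (∃ Θ ∈ Submodule.span ℂ ((fun B : Module.End ℚ (bettiCohomology (A.prod E).X 1) => B.baseChange ℂ) ''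
          (𝔞 : Set (Module.End ℚ (bettiCohomology (A.prod E).X 1)))),
        ∀ p, ∀ x ∈ (BettiUniverse.hodge exists_isReal_hodgeModel_holds hP 1).piece p (((1 : ℕ) : ℤ) - p),
          Θ x = ((2 * p - ((1 : ℕ) : ℤ) : ℤ) : ℂ) • x) →
      (BettiUniverse.hodge exists_isReal_hodgeModel_holds hP 1).hodgeLie ≤ 𝔞 :=
  hodgeLie_rigid_prod_nonCMCurve_of_rigid hA hP hrigA hE1 hEcm fun u =>
    hom_eq_zero_of_isSimple_of_not_isIsogenous hAs (isSimple_of_dim_le_one hE1.le)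
      (fun h => by have hd : A.dim = E.dim := dim_eq_of_isIsogenous_holds h; rw [hE1] at hd; omega) u

/-! ## §2 Monotonicity: `t((A × E) × Y) ≥ t(A × E) = t(A) + 3` -/

/-- **`t(A) + 3 ≤ t(X)` for every `X ∼ (A × E) × Y`**: `H¹A` `Θ`-rigid, `0 < dim A`, `E` a non-CM elliptic curve with `Hom(A, E) = 0`, `Y` ARBITRARY
(`t(A × E) = t(A) + 3`, `CorCM/MumfordTateRankTimesNonCMCurve`; `H¹(A × E)` is `Θ`-rigid, §1; rigid-factor monotonicity).
[cite: MoonenZarhin1999LowDim, §3 (3.1) and Lemma (3.4)] -/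
theorem mtRank_hodge_one_add_three_le_of_isIsogenous_prod_nonCMCurve_prod_of_rigid (hX : IsSmoothProjective n X.X)
    (hA : IsSmoothProjective n₁ A.X) (hA0 : 0 < A.dim)
    (hrigA : haveI := BettiUniverse.finite hA 1
      ∀ 𝔞 : Submodule ℚ (Module.End ℚ (bettiCohomology A.X 1)),
        𝔞 ≤ (BettiUniverse.hodge exists_isReal_hodgeModel_holds hA 1).hodgeLie →
        (∀ B ∈ 𝔞, ∀ B' ∈ 𝔞, B * B' - B' * B ∈ 𝔞) →
        (∃ Θ ∈ Submodule.span ℂ ((fun B : Module.End ℚ (bettiCohomology A.X 1) => B.baseChange ℂ) ''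
            (𝔞 : Set (Module.End ℚ (bettiCohomology A.X 1)))),
          ∀ p, ∀ x ∈ (BettiUniverse.hodge exists_isReal_hodgeModel_holds hA 1).piece p (((1 : ℕ) : ℤ) - p),
            Θ x = ((2 * p - ((1 : ℕ) : ℤ) : ℤ) : ℂ) • x) →
        (BettiUniverse.hodge exists_isReal_hodgeModel_holds hA 1).hodgeLie ≤ 𝔞)
    (hE1 : E.dim = 1) (hEcm : ¬ IsOfCMType E) (hAE : ∀ u : A ⟶ E, u = 0) {Y : AbelianVariety ℂ}
    (hXP : IsIsogenous X ((A.prod E).prod Y)) :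
    haveI := BettiUniverse.finite hX 1
    haveI := BettiUniverse.finite hA 1
    (BettiUniverse.hodge exists_isReal_hodgeModel_holds hA 1).mtRank + 3 ≤ (BettiUniverse.hodge exists_isReal_hodgeModel_holds hX 1).mtRank := by
  have hnA : A.dim = n₁ := schemeDim_eq_holds hA
  subst hnA
  haveI := BettiUniverse.finite hX 1
  haveI := BettiUniverse.finite hA 1
  have hP : IsSmoothProjective (A.prod E).dim (A.prod E).X := AbelianVariety.isSmoothProjective_holds
  haveI := BettiUniverse.finite hP 1
  have hrig := hodgeLie_rigid_prod_nonCMCurve_of_rigid hA hP hrigA hE1 hEcm hAE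
  have hle := mtRank_hodge_one_le_of_isIsogenous_prod_of_rigid (X₂ := Y) hX hP (by rw [dim_prod]; omega) hrig hXP
  have hAE3 := mtRank_hodge_one_eq_add_three_of_isIsogenous_prod_nonCMCurve hP hA hA0 hE1 hEcm hAE (IsIsogenous.refl _)
  omega

/-- **`H¹(T × E)` is `Θ`-rigid and `13 ≤ t(X)` for every `X ∼ (T × E) × Y`**, `T` a simple abelian threefold with `dim_ℚ End⁰T = 2` (type IV(2,1),
`t(T) = 10`, `Θ`-rigid by `hodgeLie_rigid_of_isSimple_threefold_of_finrank_endAlgebra_eq_two`), `E` a non-CM elliptic curve, `Y` arbitrary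
(`t(T × E) = 13`). [cite: MoonenZarhin1999LowDim, §2 (2.3), §3 (3.1) and Lemma (3.4)] -/
theorem thirteen_le_mtRank_hodge_one_of_isIsogenous_threefold_prod_nonCMCurve_prod (hX : IsSmoothProjective n X.X) {T : AbelianVariety ℂ}
    (hTs : T.IsSimple) (hT3 : T.dim = 3) (hTE : Module.finrank ℚ T.endAlgebra = 2) (hE1 : E.dim = 1) (hEcm : ¬ IsOfCMType E)
    {Y : AbelianVariety ℂ} (hXP : IsIsogenous X ((T.prod E).prod Y)) :
    haveI := BettiUniverse.finite hX 1
    13 ≤ (BettiUniverse.hodge exists_isReal_hodgeModel_holds hX 1).mtRank := by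
  have hT : IsSmoothProjective T.dim T.X := AbelianVariety.isSmoothProjective_holds
  haveI := BettiUniverse.finite hX 1
  haveI := BettiUniverse.finite hT 1
  have h10 : (BettiUniverse.hodge exists_isReal_hodgeModel_holds hT 1).mtRank = 10 :=
    (mtRank_hodge_one_of_isSimple_threefold_of_finrank_endAlgebra_eq_two hT hTs hT3 hTE).1
  have h := mtRank_hodge_one_add_three_le_of_isIsogenous_prod_nonCMCurve_prod_of_rigid hX hT (by omega)
    (hodgeLie_rigid_of_isSimple_threefold_of_finrank_endAlgebra_eq_two hT hTs hT3 hTE) hE1 hEcm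
    (fun u => hom_eq_zero_of_isSimple_of_not_isIsogenous hTs (isSimple_of_dim_le_one hE1.le)
      (fun h => by have hd : T.dim = E.dim := dim_eq_of_isIsogenous_holds h; rw [hE1] at hd; omega) u) hXP
  omega

/-- **`g² + 4 ≤ t(X)` for every `X ∼ (A × E) × Y`, `A` of Ribet type `(g − 1, 1)`** (`IsField End⁰A` not totally real, `dim_ℚ End⁰A = 2`, `φ ∘ φ = −d`,
multiplicity one at `±i√d`, `g ≥ 3`; `t(A) = g² + 1`, `Θ`-rigid), `E` a non-CM elliptic curve, `Y` arbitrary.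
[cite: MoonenZarhin1999LowDim, §3 (3.1) and Lemma (3.4)] [cite: Ribet1983, Thm. 3] -/
theorem mtRank_hodge_one_le_of_isIsogenous_ribetTypeOne_prod_nonCMCurve_prod (hX : IsSmoothProjective n X.X) (hF : IsField A.endAlgebra)
    (hnR : ¬ NumberField.IsTotallyReal (EndField A hF)) (φ : A ⟶ A) {d : ℕ} (hd : 0 < d) (hφ : φ ≫ φ = -(d • 𝟙 A))
    (hA2 : Module.finrank ℚ A.endAlgebra = 2)
    (h1 : eigenMultiplicity A φ (Complex.I * (Real.sqrt d : ℂ)) = 1 ∨ eigenMultiplicity A φ (-(Complex.I * (Real.sqrt d : ℂ))) = 1)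
    (hdim : 3 ≤ A.dim) (hE1 : E.dim = 1) (hEcm : ¬ IsOfCMType E) (hAE : ∀ u : A ⟶ E, u = 0) {Y : AbelianVariety ℂ}
    (hXP : IsIsogenous X ((A.prod E).prod Y)) :
    haveI := BettiUniverse.finite hX 1
    A.dim * A.dim + 4 ≤ (BettiUniverse.hodge exists_isReal_hodgeModel_holds hX 1).mtRank := by
  have hA : IsSmoothProjective A.dim A.X := AbelianVariety.isSmoothProjective_holds
  haveI := BettiUniverse.finite hX 1
  haveI := BettiUniverse.finite hA 1
  have hgg := (mtRank_hodge_one_of_ribetTypeOne' hA hF hnR φ hd hφ hA2 h1 hdim).1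
  have h := mtRank_hodge_one_add_three_le_of_isIsogenous_prod_nonCMCurve_prod_of_rigid hX hA (by omega)
    (hodgeLie_rigid_of_ribetTypeOne hA φ hd hφ hA2 h1 hdim) hE1 hEcm hAE hXP
  omega

end Summit.HodgeConjecture.CorCM

end
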